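import Mathlib.Analysis.Calculus.Deriv.Mul
import Mathlib.Analysis.Calculus.Deriv.Add
import Mathlib.LinearAlgebra.Matrix.Determinant.Basic
import HarnessLib

/-!
# First and second derivatives of the determinant of a `3 × 3` matrix path

Elementary calculus for the determinant `s ↦ det R(s)` of a path of real `3 × 3` matrices given by
differentiable entry functions (Jacobi's formula in dimension three, written out with
`Matrix.det_fin_three`): the derivative at every point (`hasDerivAt_det_fin_three`), and the second
derivative at a point where the matrix is DIAGONAL, `R(0) = diag(d₀, d₁, d₂)`:

  `(det R)''(0) = d₁d₂ C₀₀ + d₀d₂ C₁₁ + d₀d₁ C₂₂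
      + 2 (d₂ B₀₀B₁₁ + d₁ B₀₀B₂₂ + d₀ B₁₁B₂₂ − d₀ B₁₂B₂₁ − d₂ B₀₁B₁₀ − d₁ B₀₂B₂₀)`,

`B = R'(0)`, `C = R''(0)` (`hasDerivAt_detDeriv_fin_three_diag`) — the expansion
`det(D + tB + t²C/2) = det D + t·tr(adj(D) B) + t²(…)` used for the function `det(Ric♯)` along
geodesics with parallel frames in the classification of compact three-dimensional shrinking Ricci
solitons (`Literature/Geometry/Riemannian/`, the degenerate case). Everything is proved; no
definitions are introduced.

## References

* R. A. Horn, C. R. Johnson, *Matrix Analysis*, 2nd ed., CUP 2013, §0.8.10 (Jacobi's formula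
  `d det A = tr(adj A dA)`). [folklore]
-/

noncomputable section

namespace Literature.Analysis.Matrix

/-- Product rule for three factors. [folklore] -/
theorem hasDerivAt_mul_three {f g h : ℝ → ℝ} {f' g' h' s : ℝ} (hf : HasDerivAt f f' s)
    (hg : HasDerivAt g g' s) (hh : HasDerivAt h h' s) :
    HasDerivAt (fun σ ↦ f σ * g σ * h σ) (f' * g s * h s + f s * g' * h s + f s * g s * h') s := by
  have := (hf.mul hg).mul hh
  refine this.congr_deriv ?_
  simp only [Pi.mul_apply]
  ring

/-- **The derivative of a `3 × 3` determinant** (Jacobi's formula written out with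
`Matrix.det_fin_three`): for entry functions `r i j` with derivatives `r₁ i j s` at `s`.
[folklore] -/
theorem hasDerivAt_det_fin_three {r : Fin 3 → Fin 3 → ℝ → ℝ} {r₁ : Fin 3 → Fin 3 → ℝ} {s : ℝ}
    (h : ∀ i j, HasDerivAt (r i j) (r₁ i j) s) :
    HasDerivAt (fun σ ↦ Matrix.det (Matrix.of fun i j ↦ r i j σ))
      ((r₁ 0 0 * r 1 1 s * r 2 2 s + r 0 0 s * r₁ 1 1 * r 2 2 s + r 0 0 s * r 1 1 s * r₁ 2 2)
        - (r₁ 0 0 * r 1 2 s * r 2 1 s + r 0 0 s * r₁ 1 2 * r 2 1 s + r 0 0 s * r 1 2 s * r₁ 2 1)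
        - (r₁ 0 1 * r 1 0 s * r 2 2 s + r 0 1 s * r₁ 1 0 * r 2 2 s + r 0 1 s * r 1 0 s * r₁ 2 2)
        + (r₁ 0 1 * r 1 2 s * r 2 0 s + r 0 1 s * r₁ 1 2 * r 2 0 s + r 0 1 s * r 1 2 s * r₁ 2 0)
        + (r₁ 0 2 * r 1 0 s * r 2 1 s + r 0 2 s * r₁ 1 0 * r 2 1 s + r 0 2 s * r 1 0 s * r₁ 2 1)
        - (r₁ 0 2 * r 1 1 s * r 2 0 s + r 0 2 s * r₁ 1 1 * r 2 0 s + r 0 2 s * r 1 1 s * r₁ 2 0)) s := by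
  have hfun : (fun σ ↦ Matrix.det (Matrix.of fun i j ↦ r i j σ)) = fun σ ↦
      r 0 0 σ * r 1 1 σ * r 2 2 σ - r 0 0 σ * r 1 2 σ * r 2 1 σ
      - r 0 1 σ * r 1 0 σ * r 2 2 σ + r 0 1 σ * r 1 2 σ * r 2 0 σ
      + r 0 2 σ * r 1 0 σ * r 2 1 σ - r 0 2 σ * r 1 1 σ * r 2 0 σ := by
    funext σ
    rw [Matrix.det_fin_three]
    rfl
  rw [hfun]
  exact ((((hasDerivAt_mul_three (h 0 0) (h 1 1) (h 2 2)).fun_sub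
    (hasDerivAt_mul_three (h 0 0) (h 1 2) (h 2 1))).fun_sub
    (hasDerivAt_mul_three (h 0 1) (h 1 0) (h 2 2))).fun_add
    (hasDerivAt_mul_three (h 0 1) (h 1 2) (h 2 0))).fun_add
    (hasDerivAt_mul_three (h 0 2) (h 1 0) (h 2 1)) |>.fun_sub
    (hasDerivAt_mul_three (h 0 2) (h 1 1) (h 2 0))

/-- **The second derivative of a `3 × 3` determinant at a diagonal point.** If the entries `r i j`
have derivatives `r₁ i j σ` near `0`, the `r₁ i j` have derivatives `r₂ i j` at `0`, and
`R(0) = diag(d)` (`r i i 0 = d i`, `r i j 0 = 0` for `i ≠ j`), then the derivative at `0` of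
Jacobi's expression for `(det R)'` is
`d₁d₂ C₀₀ + d₀d₂ C₁₁ + d₀d₁ C₂₂ + 2(d₂B₀₀B₁₁ + d₁B₀₀B₂₂ + d₀B₁₁B₂₂ − d₀B₁₂B₂₁ − d₂B₀₁B₁₀ − d₁B₀₂B₂₀)`
with `B = r₁ · · 0`, `C = r₂`. [folklore] -/
theorem hasDerivAt_detDeriv_fin_three_diag {r r₁ : Fin 3 → Fin 3 → ℝ → ℝ}
    {r₂ : Fin 3 → Fin 3 → ℝ} {d : Fin 3 → ℝ}
    (h₁ : ∀ i j, HasDerivAt (r i j) (r₁ i j 0) 0) (h₂ : ∀ i j, HasDerivAt (r₁ i j) (r₂ i j) 0)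
    (hd : ∀ i, r i i 0 = d i) (hoff : ∀ i j, i ≠ j → r i j 0 = 0) :
    HasDerivAt (fun s ↦
      (r₁ 0 0 s * r 1 1 s * r 2 2 s + r 0 0 s * r₁ 1 1 s * r 2 2 s + r 0 0 s * r 1 1 s * r₁ 2 2 s)
        - (r₁ 0 0 s * r 1 2 s * r 2 1 s + r 0 0 s * r₁ 1 2 s * r 2 1 s + r 0 0 s * r 1 2 s * r₁ 2 1 s)
        - (r₁ 0 1 s * r 1 0 s * r 2 2 s + r 0 1 s * r₁ 1 0 s * r 2 2 s + r 0 1 s * r 1 0 s * r₁ 2 2 s)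
        + (r₁ 0 1 s * r 1 2 s * r 2 0 s + r 0 1 s * r₁ 1 2 s * r 2 0 s + r 0 1 s * r 1 2 s * r₁ 2 0 s)
        + (r₁ 0 2 s * r 1 0 s * r 2 1 s + r 0 2 s * r₁ 1 0 s * r 2 1 s + r 0 2 s * r 1 0 s * r₁ 2 1 s)
        - (r₁ 0 2 s * r 1 1 s * r 2 0 s + r 0 2 s * r₁ 1 1 s * r 2 0 s + r 0 2 s * r 1 1 s * r₁ 2 0 s))
      (d 1 * d 2 * r₂ 0 0 + d 0 * d 2 * r₂ 1 1 + d 0 * d 1 * r₂ 2 2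
        + 2 * (d 2 * r₁ 0 0 0 * r₁ 1 1 0 + d 1 * r₁ 0 0 0 * r₁ 2 2 0 + d 0 * r₁ 1 1 0 * r₁ 2 2 0
          - d 0 * r₁ 1 2 0 * r₁ 2 1 0 - d 2 * r₁ 0 1 0 * r₁ 1 0 0 - d 1 * r₁ 0 2 0 * r₁ 2 0 0)) 0 := by
  -- each monomial `f g h` of Jacobi's expression
  have T : ∀ (i j k l m n : Fin 3),
      HasDerivAt (fun s ↦ r₁ i j s * r k l s * r m n s + r i j s * r₁ k l s * r m n s
          + r i j s * r k l s * r₁ m n s)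
        ((r₂ i j * r k l 0 * r m n 0 + r₁ i j 0 * r₁ k l 0 * r m n 0 + r₁ i j 0 * r k l 0 * r₁ m n 0)
          + (r₁ i j 0 * r₁ k l 0 * r m n 0 + r i j 0 * r₂ k l * r m n 0 + r i j 0 * r₁ k l 0 * r₁ m n 0)
          + (r₁ i j 0 * r k l 0 * r₁ m n 0 + r i j 0 * r₁ k l 0 * r₁ m n 0 + r i j 0 * r k l 0 * r₂ m n))
        0 := fun i j k l m n ↦
    ((hasDerivAt_mul_three (h₂ i j) (h₁ k l) (h₁ m n)).fun_add
      (hasDerivAt_mul_three (h₁ i j) (h₂ k l) (h₁ m n))).fun_add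
      (hasDerivAt_mul_three (h₁ i j) (h₁ k l) (h₂ m n))
  have hall := ((((T 0 0 1 1 2 2).fun_sub (T 0 0 1 2 2 1)).fun_sub (T 0 1 1 0 2 2)).fun_add
    (T 0 1 1 2 2 0)).fun_add (T 0 2 1 0 2 1) |>.fun_sub (T 0 2 1 1 2 0)
  refine hall.congr_deriv ?_
  simp only [hd, hoff 0 1 (by decide), hoff 0 2 (by decide), hoff 1 0 (by decide),
    hoff 1 2 (by decide), hoff 2 0 (by decide), hoff 2 1 (by decide)]
  ring

end Literature.Analysis.Matrix

end
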